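import Summits.Ventures.PercRepro.RankLevelSetPerElemChainTriple
import Summits.Ventures.PercRepro.RankLevelSetStarPlusCircuits
import Summits.Ventures.PercRepro.RankLevelSetStarPlusThree

/-! # RankLevelSetStarPlusSeries — (★★)⁺ AT LEVEL `4` ON EVERY MATROID WHOSE COCIRCUITS HAVE `≥ 3` ELEMENTS, BY THE
REFINED CHAIN (night-1 g37; dossier §49.8; on `RankLevelSetPerElemChainTriple`, `RankLevelSetStarPlusCircuits`,
`RankLevelSetStarPlusThree`)

The per-circuit reflection of `RankLevelSetStarPlusCircuits` closes the circuit class of `K` at level `i` when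
`#K ≥ i`; with the refined coloop bound — `≤ ρ − 2` coloops in a spanning set of more than `ρ` nonloops containing no
parallel pair (**`ncard_coloops_add_two_le_of_no_pair`**, **`absorbFam_step_of_no_pair`**) — it closes when
`#K + 1 ≥ i` (**`starPlus_perCircuit_of_no_pair`**), provided `E ∖ K` contains no parallel pair of `M✶`, i.e. no
SERIES PAIR (`2`-element cocircuit) of `M`. At level `4` every circuit of an element in no parallel pair
qualifies, so **`starPlus_four_of_cocircuits`**: `A^y_4 ≤ A^y_{#E − 4}` at every element of every matroid whose
cocircuits all have `≥ 3` elements (`8 < #E`; a loop absorbs nothing, an element of a parallel pair reduces to the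
symmetric profile of a minor, and such a matroid has no coloops); hence **`biIndepStarPlus_of_cocircuits_of_ncard_le_ten`**:
(★★)⁺ on every such matroid with `≤ 10` elements. Every declaration has a docstring; imports: the cell's own modules
and Mathlib only. Axioms: standard. -/

namespace PercRepro

open Set Matroid

variable {α : Type}

/-! ## The coloop bound without parallel pairs -/

/-- **A set `Y` of nonloops of rank `≤ ρ` with more than `ρ` elements and no parallel pair has at most `ρ − 2`
coloops**: the non-coloops `Y'` have `≥ 2` elements and, not being parallel, rank `≥ 2`. -/
lemma ncard_coloops_add_two_le_of_no_pair {N : Matroid α} [N.Finite] {Y : Set α} (hYE : Y ⊆ N.E)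
    (hnl : ∀ e ∈ Y, N.IsNonloop e) (hnp : ∀ p ∈ Y, ∀ q ∈ Y, p ≠ q → q ∉ N.closure {p})
    {ρ : ℕ} (hρ : N.eRk Y ≤ ρ) (hY : ρ < Y.ncard) :
    {t ∈ Y | t ∉ N.closure (Y \ {t})}.ncard + 2 ≤ ρ := by
  classical
  set C := {t ∈ Y | t ∉ N.closure (Y \ {t})} with hC
  have hYfin : Y.Finite := N.ground_finite.subset hYE
  have hCY : C ⊆ Y := fun t ht => ht.1
  have hCfin : C.Finite := hYfin.subset hCY
  set Y' := Y \ C with hY'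
  have hsplit : Y = Y' ∪ ↑hCfin.toFinset := by
    rw [hCfin.coe_toFinset, Set.sdiff_union_of_subset hCY]
  have hsk : ∀ d ∈ hCfin.toFinset, d ∉ N.closure (Y' ∪ (↑hCfin.toFinset \ {d})) := by
    intro d hd
    rw [hCfin.mem_toFinset] at hd
    intro h
    apply hd.2
    refine N.closure_subset_closure ?_ h
    rw [hCfin.coe_toFinset]
    intro x hx
    rcases hx with hx | hx
    · exact ⟨hx.1, fun h => hx.2 (by rw [Set.mem_singleton_iff] at h; rw [h]; exact hd)⟩
    · exact ⟨hCY hx.1, hx.2⟩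
  have hrk : N.eRk Y = N.eRk Y' + (hCfin.toFinset.card : ℕ∞) := by
    rw [hsplit] at hρ ⊢
    exact eRk_union_eq_add_encard_of_forall_notMem_closure hCfin.toFinset
      (by rw [hCfin.coe_toFinset]; exact hCY.trans hYE) hsk
  have hCcard : hCfin.toFinset.card = C.ncard := (Set.ncard_eq_toFinset_card C hCfin).symm
  have hold : C.ncard + 1 ≤ ρ := ncard_coloops_add_one_le hYE hnl hρ hY
  have hY'card : Y'.ncard = Y.ncard - C.ncard := Set.ncard_sdiff hCY hCfin
  have hY'2 : 1 < Y'.ncard := by omega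
  have hY'fin : Y'.Finite := hYfin.subset Set.sdiff_subset
  have hY'E : Y' ⊆ N.E := Set.sdiff_subset.trans hYE
  -- the rank of `Y'` is at least `2`
  have h2 : (2 : ℕ∞) ≤ N.eRk Y' := by
    by_contra hlt
    have hlt2 : N.eRk Y' < 2 := not_le.mp hlt
    rw [← one_add_one_eq_two] at hlt2
    have hle1 : N.eRk Y' ≤ 1 := Order.le_of_lt_add_one hlt2
    obtain ⟨u, hu⟩ : Y'.Nonempty := by
      rw [← Set.ncard_pos hY'fin]; omega
    have h1 : (1 : ℕ∞) ≤ N.eRk Y' := by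
      rw [← (hnl u hu.1).eRk_eq]
      exact N.eRk_mono (Set.singleton_subset_iff.mpr hu)
    have heq : N.eRk Y' = 1 := le_antisymm hle1 h1
    obtain ⟨e, heY', -, hsub⟩ := (Matroid.eRk_eq_one_iff hY'E).mp heq
    obtain ⟨q, hq⟩ : (Y' \ {e}).Nonempty := by
      rw [← Set.ncard_pos (hY'fin.subset Set.sdiff_subset), Set.ncard_sdiff_singleton_of_mem heY']; omega
    have hqe : q ≠ e := by simpa using hq.2
    exact hnp e heY'.1 q hq.1.1 hqe.symm (hsub hq.1)
  have h3 : ((C.ncard + 2 : ℕ) : ℕ∞) ≤ ρ := by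
    calc ((C.ncard + 2 : ℕ) : ℕ∞) = (hCfin.toFinset.card : ℕ∞) + 2 := by rw [hCcard]; push_cast; ring
      _ ≤ (hCfin.toFinset.card : ℕ∞) + N.eRk Y' := by gcongr
      _ = N.eRk Y := by rw [hrk, add_comm]
      _ ≤ ρ := hρ
  exact_mod_cast h3

/-- **THE UP-SHADOW STEP WITHOUT PARALLEL PAIRS**: for `H ⊆ N.E` of nonloops with `rk H ≤ ρ`, no parallel pair of `N`
inside `H`, `y ∉ cl H`, `insert y H` spanning, and `i + ρ < #H`: `(#H − i − (ρ − 2)) · f i ≤ (i + 1) · f (i + 1)`. -/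
theorem absorbFam_step_of_no_pair {N : Matroid α} [N.Finite] {H S : Set α} {y : α} (hHE : H ⊆ N.E)
    (hSE : S ⊆ N.E) (hyE : y ∈ N.E) (hyH : y ∉ N.closure H) (hHy : N.Spanning (insert y H))
    (hnl : ∀ e ∈ H, N.IsNonloop e) (hnp : ∀ p ∈ H, ∀ q ∈ H, p ≠ q → q ∉ N.closure {p})
    {ρ : ℕ} (hρ : N.eRk H ≤ ρ) {i : ℕ} (hi : i + ρ < H.ncard) :
    (H.ncard - i - (ρ - 2)) *
        {X | X ⊆ H ∧ X.ncard = i ∧ N.Spanning (S ∪ X) ∧ N.Spanning (insert y (H \ X))}.ncard ≤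
      (i + 1) * {X | X ⊆ H ∧ X.ncard = i + 1 ∧ N.Spanning (S ∪ X) ∧ N.Spanning (insert y (H \ X))}.ncard := by
  refine absorbFam_step_of_bound hHE hSE hyE hyH hHy ?_
  intro X hXH hXi hYcl
  have hHfin : H.Finite := N.ground_finite.subset hHE
  have hYE : H \ X ⊆ N.E := Set.sdiff_subset.trans hHE
  have hYcard : (H \ X).ncard = H.ncard - i := by rw [Set.ncard_sdiff hXH (hHfin.subset hXH), hXi]
  have hYρ : N.eRk (H \ X) ≤ ρ := (N.eRk_mono Set.sdiff_subset).trans hρ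
  have h := ncard_coloops_add_two_le_of_no_pair hYE (fun e he => hnl e he.1)
    (fun p hp q hq hpq => hnp p hp.1 q hq.1 hpq) hYρ (by omega)
  omega

/-! ## The per-circuit reflection with the refined chain -/

variable (M : Matroid α) [M.Finite]

/-- **THE PER-CIRCUIT REFLECTION OF (★★)⁺ AT LEVEL `i` BY THE REFINED CHAIN** (coloop-free `M`, `y` in no parallel
pair, `3 ≤ i`, `2i < #E`): for an absorbing `i`-set `Z₀` whose circuit `K = C_y(Z₀)` has `#K + 1 ≥ i` elements and
whose complement `E ∖ K` contains no parallel pair of `M✶` (no series pair of `M`), the members of `K` at level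
`i` are at most those at level `#E − i`. -/
theorem starPlus_perCircuit_of_no_pair (hcol : ∀ e, ¬ M.IsColoop e) {y : α} (hy : y ∈ M.E)
    (hnp : ∀ z, z ≠ y → y ∉ M.closure {z}) {i : ℕ} (hi3 : 3 ≤ i)
    (hn : 2 * i < M.E.ncard) {Z₀ : Set α} (hZ₀ : Z₀ ∈ lowAbsorbAt M y i)
    (hnp2 : ∀ p ∈ M.E \ M.fundCircuit y Z₀, ∀ q ∈ M.E \ M.fundCircuit y Z₀, p ≠ q → q ∉ M✶.closure {p})
    (hK : i ≤ (M.fundCircuit y Z₀).ncard + 1) :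
    {Z ∈ lowAbsorbAt M y i | M.fundCircuit y Z = M.fundCircuit y Z₀}.ncard ≤
      {Z ∈ lowAbsorbAt M y (M.E.ncard - i) | M.fundCircuit y Z = M.fundCircuit y Z₀}.ncard := by
  obtain ⟨hKeq, hSZ, hSE, hHE, -, -, hHy, hyH, hnl, -⟩ := circuit_dual_facts M hcol hy hZ₀
  have h1 := members_le_fam M hy hZ₀
  have h2 := fam_le_absorb M hy hZ₀ (M.E.ncard - i - (M.fundCircuit y Z₀ \ {y}).ncard)
  obtain ⟨z₀, hz₀⟩ : (M.E \ {y}).Nonempty := by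
    rw [← Set.ncard_pos (M.ground_finite.subset Set.sdiff_subset), Set.ncard_sdiff_singleton_of_mem hy]
    omega
  have hz₀y : z₀ ≠ y := by simpa using hz₀.2
  have hK3 := (fundCircuit_ncard_absorb M hy hnp hz₀y hZ₀).1
  have hZE : Z₀ ⊆ M.E := hZ₀.1.1
  have hZi : Z₀.ncard = i := hZ₀.1.2.1
  set K := M.fundCircuit y Z₀ with hK'
  set S := K \ {y} with hS
  set H := M.E \ K with hH
  have hyK : y ∈ K := M.mem_fundCircuit y Z₀
  have hKE : K ⊆ M.E := hKeq ▸ Set.insert_subset hy hSE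
  have hKfin : K.Finite := M.ground_finite.subset hKE
  have hKcard : K.ncard = S.ncard + 1 := by
    rw [hS, Set.ncard_sdiff_singleton_of_mem hyK]
    have : 1 ≤ K.ncard := (Set.ncard_pos hKfin).mpr ⟨y, hyK⟩
    omega
  have hKle : K.ncard ≤ M.E.ncard := Set.ncard_le_ncard hKE M.ground_finite
  have hHcard : H.ncard + K.ncard = M.E.ncard := by
    rw [hH, Set.ncard_sdiff hKE hKfin]; omega
  have hsi : S.ncard ≤ i := by
    rw [← hZi]; exact Set.ncard_le_ncard hSZ (M.ground_finite.subset hZE)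
  have hyE' : y ∈ M✶.E := by rwa [Matroid.dual_ground]
  have hHE' : H ⊆ M✶.E := by rwa [Matroid.dual_ground]
  have hSE' : S ⊆ M✶.E := by rwa [Matroid.dual_ground]
  -- `rk M✶ ≤ i` since the bi-independent `i`-set `Z₀` spans `M✶`; so the hyperplane has rank `≤ i − 1`
  have hν : M✶.eRank ≤ ((i : ℕ) : ℕ∞) := by
    have hsp : M✶.Spanning Z₀ := (indep_compl_iff_dual_spanning M hZE).mp hZ₀.1.2.2.2
    rw [← hsp.eRk_eq]
    refine le_trans (M✶.eRk_le_encard Z₀) ?_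
    rw [← (M.ground_finite.subset hZE).cast_ncard_eq, hZi]
  have hρ : M✶.eRk H ≤ ((i - 1 : ℕ) : ℕ∞) := by
    have h : M✶.eRk H + 1 ≤ ((i - 1 : ℕ) : ℕ∞) + 1 := by
      rw [eRk_add_one_eq_eRank_of_spanning_insert hyE' hyH hHy]
      refine le_trans hν ?_
      exact_mod_cast (show i ≤ i - 1 + 1 by omega)
    exact (WithTop.add_le_add_iff_right (by decide)).mp h
  have hs2 : 2 ≤ S.ncard := by omega
  set f : ℕ → ℕ := fun j =>
    {X | X ⊆ H ∧ X.ncard = j ∧ M✶.Spanning (S ∪ X) ∧ M✶.Spanning (insert y (H \ X))}.ncard with hf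
  have hchain : f (i - S.ncard) ≤ f (M.E.ncard - i - S.ncard) := by
    have hm : M.E.ncard - i - S.ncard = (i - S.ncard) + (M.E.ncard - 2 * i) := by omega
    rw [hm]
    refine le_of_chain f (c := M.E.ncard - i - (i - 2)) (by omega) ?_
    intro t ht
    have hstep := absorbFam_step_of_no_pair (S := S) hHE' hSE' hyE' hyH hHy hnl hnp2 hρ
      (i := i - S.ncard + t) (by omega)
    have e1 : H.ncard - (i - S.ncard + t) - (i - 1 - 2) = M.E.ncard - i - (i - 2) - t := by omega
    rw [e1] at hstep
    exact hstep
  have e2 : M.E.ncard - i - S.ncard + S.ncard = M.E.ncard - i := by omega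
  rw [e2] at h2
  calc {Z ∈ lowAbsorbAt M y i | M.fundCircuit y Z = M.fundCircuit y Z₀}.ncard ≤ f (i - S.ncard) := h1
    _ ≤ f (M.E.ncard - i - S.ncard) := hchain
    _ ≤ _ := h2

/-- **(★★)⁺ AT LEVEL `4` ON A COLOOP-FREE MATROID WITHOUT A SERIES PAIR, AT AN ELEMENT IN NO PARALLEL PAIR**
(`8 < #E`): `A^y_4 ≤ A^y_{#E − 4}` — every circuit of `y` has `≥ 3 = 4 − 1` elements. -/
theorem starPlus_four_of_coloopFree_of_no_pair (hcol : ∀ e, ¬ M.IsColoop e)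
    (hnp2 : ∀ p q, p ≠ q → M✶.IsNonloop p → q ∉ M✶.closure {p}) {y : α} (hy : y ∈ M.E)
    (hnp : ∀ z, z ≠ y → y ∉ M.closure {z}) (hn : 8 < M.E.ncard) :
    lowAbsorbCount M y 4 ≤ lowAbsorbCount M y (M.E.ncard - 4) := by
  unfold lowAbsorbCount
  refine absorb_le_of_perCircuit_levels M 4 (M.E.ncard - 4) ?_
  intro Z₀ hZ₀
  obtain ⟨z₀, hz₀⟩ : (M.E \ {y}).Nonempty := by
    rw [← Set.ncard_pos (M.ground_finite.subset Set.sdiff_subset), Set.ncard_sdiff_singleton_of_mem hy]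
    omega
  have hz₀y : z₀ ≠ y := by simpa using hz₀.2
  have h3 := (fundCircuit_ncard_absorb M hy hnp hz₀y hZ₀).1
  refine starPlus_perCircuit_of_no_pair M hcol hy hnp (by norm_num) hn hZ₀ ?_ (by omega)
  intro p hp q hq hpq
  have hpnl : M✶.IsNonloop p := by
    refine Matroid.isNonloop_of_not_isLoop (by rw [Matroid.dual_ground]; exact hp.1) ?_
    rw [Matroid.dual_isLoop_iff_isColoop]
    exact hcol p
  exact hnp2 p q hpq hpnl

omit [M.Finite] in
/-- **A matroid whose cocircuits all have `≥ 3` elements has no coloops and no two distinct elements parallel in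
the dual.** -/
lemma no_coloop_and_no_pair_of_cocircuits (hc : ∀ C, M.IsCocircuit C → 3 ≤ C.ncard) :
    (∀ e, ¬ M.IsColoop e) ∧ (∀ p q, p ≠ q → M✶.IsNonloop p → q ∉ M✶.closure {p}) := by
  refine ⟨?_, ?_⟩
  · intro e he
    have h := hc {e} he.isCocircuit
    simp at h
  · intro p q hpq hp hq
    have hqp : q ∉ ({p} : Set α) := by simpa using hpq.symm
    obtain ⟨C, hCsub, hC, -⟩ := Matroid.exists_isCircuit_of_mem_closure hq hqp
    have h3 := hc C hC
    have hCle : C.ncard ≤ ({q, p} : Set α).ncard := Set.ncard_le_ncard (by simpa using hCsub) (Set.toFinite _)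
    have h2 : ({q, p} : Set α).ncard ≤ 2 := by
      have := Set.ncard_insert_le q ({p} : Set α)
      rw [Set.ncard_singleton] at this
      exact this
    omega

/-- **(★★)⁺ AT LEVEL `4` AT EVERY ELEMENT OF EVERY MATROID WHOSE COCIRCUITS HAVE `≥ 3` ELEMENTS** (`8 < #E`):
`A^y_4 ≤ A^y_{#E − 4}`. A loop absorbs nothing; an element of a parallel pair `{y, z}` has the symmetric profile
`A^y_{j+1} = D_j(M ／ y ＼ z)` on both sides; otherwise `y` is in no parallel pair and the matroid is coloop-free. -/
theorem starPlus_four_of_cocircuits (hc : ∀ C, M.IsCocircuit C → 3 ≤ C.ncard) {y : α} (hy : y ∈ M.E)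
    (hn : 8 < M.E.ncard) : lowAbsorbCount M y 4 ≤ lowAbsorbCount M y (M.E.ncard - 4) := by
  classical
  obtain ⟨hcol, hnp2⟩ := no_coloop_and_no_pair_of_cocircuits M hc
  by_cases hl : M.IsLoop y
  · rw [lowAbsorbCount_eq_zero_of_isLoop M hl 4]; exact Nat.zero_le _
  by_cases hp : ∃ z, ParallelPair M y z
  · obtain ⟨z, hz⟩ := hp
    haveI := contract_delete_finite M y z
    have hcard := ncard_ground_contract_delete M hz
    have h4 : lowAbsorbCount M y 4 = biIndepCount ((M.contract {y}).delete {z}) 3 :=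
      lowAbsorbCount_succ_of_parallel_left M hz 3
    have hn4 : M.E.ncard - 4 = (M.E.ncard - 5) + 1 := by omega
    have h5 : lowAbsorbCount M y (M.E.ncard - 4) = biIndepCount ((M.contract {y}).delete {z}) (M.E.ncard - 5) := by
      rw [hn4]; exact lowAbsorbCount_succ_of_parallel_left M hz (M.E.ncard - 5)
    have hsym := biIndepCount_compl ((M.contract {y}).delete {z}) 3 (by rw [hcard]; omega)
    rw [hcard, show M.E.ncard - 2 - 3 = M.E.ncard - 5 by omega] at hsym
    rw [h4, h5, hsym]
  simp only [not_exists] at hp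
  exact starPlus_four_of_coloopFree_of_no_pair M hcol hnp2 hy
    (fun z hz => notMem_closure_singleton_of_no_partner M hy hl hp hz) hn

/-- **(★★)⁺ holds on every matroid with at most `10` elements whose cocircuits have `≥ 3` elements**: only the
levels `≤ 4` occur below the middle. -/
theorem biIndepStarPlus_of_cocircuits_of_ncard_le_ten (hc : ∀ C, M.IsCocircuit C → 3 ≤ C.ncard)
    (hn : M.E.ncard ≤ 10) : BiIndepStarPlus M := by
  intro y hy i hi
  rcases Nat.lt_or_ge i 3 with h3 | h3
  · exact starPlus_of_le_two M hy (by omega) hi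
  · rcases Nat.lt_or_ge i 4 with h4 | h4
    · have hi3 : i = 3 := by omega
      subst hi3
      exact starPlus_three M hy (by omega)
    · have hi4 : i = 4 := by omega
      subst hi4
      exact starPlus_four_of_cocircuits M hc hy (by omega)

end PercRepro
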